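import Literature.Computability.Complexity.GateEliminationCase5Split

/-!
# Gate elimination: Case 5.1 of Li–Yang's proof of Theorem 4.1

"When `B = C`, we can always apply a constant substitution to `x` or `y`, or an affine
substitution `x ← y ⊕ c`, such that both `G` and `B` outputs a fixed constant regardless of the
inputs. We can replace them by constants, making both `x` and `y` non-influential. Hence
`Δμ ≥ 2α_I ≥ δ`." (ECCC TR21-023, §4.1, Case 5.1.) Here `G` is the troubled ∧-type gate reading
the `2`-variables `x, y`, and `B` is the other gate reading both of them; `B` is ∧-type or (being
non-degenerate) ⊕-type. PROVED (`LiYang2022_case5_1_holds`) from the pair lemmas of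
`GateEliminationTroubledPair.lean` (`pair_const`, `pair_affine`).

## References

* J. Li, T. Yang, *3.1n − o(n) circuit lower bounds for explicit functions*, STOC 2022;
  ECCC TR21-023, §4.1 (Case 5.1), Lemma 3.11.
-/

namespace Literature.Computability.Complexity

open Finset
open Semicircuit

/-- **Case 5.1 of the proof of Thm. 4.1.** [cite: LiYang2022, §4.1 (Case 5.1)] -/
theorem LiYang2022_case5_1_holds : LiYang2022_case5_1 := by
  intro αφ αI αQ hφ0 hφ hI hQ n d f hf C R hF hC hd hS G x y B C' D aX aB aC aD hcfg hBC
  classical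
  subst hBC
  refine stepGoal_of_stepBranch2 ?_
  have hP : C.IsPacking ∅ := C.isPacking_empty
  have hand := hcfg.and_G
  have hGx := hcfg.arg_G_x
  have hGy := hcfg.arg_G_y
  have hxy := hcfg.x_ne_y
  have hBx := hcfg.arg_B
  have hBy' := hcfg.arg_C
  have hne : G ≠ B := fun h => hcfg.B_ne_G h.symm
  -- `B` reads `y` at the other position
  have haC : aC = aB.rev := by
    rcases fin2_eq_or_eq_rev aB aC with e | e
    · rw [e, hBx] at hBy'; cases hBy'; exact absurd rfl hxy
    · exact e
  rw [haC] at hBy'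
  have hxP : ¬ R.Protected x := fun hp => hS.protected_not_and x hp G aX hGx hand
  have hyP : ¬ R.Protected y := fun hp => hS.protected_not_and y hp G aX.rev hGy hand
  obtain ⟨α₁, β₁, γ₁, hop₁⟩ := hand
  -- trivializing constants of `x` and `y` in `G`
  let tz₁ : Bool := if aX = 0 then α₁ else β₁
  let tx₁ : Bool := if aX = 0 then β₁ else α₁
  have hrev : ∀ (p : Fin 2) (u v : Bool), (if p.rev = 0 then u else v) = if p = 0 then v else u := by decide
  have htz₁ : ∀ t, C.liveFn G aX tz₁ t = γ₁ := liveFn_trivConst hop₁ aX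
  have htx₁ : ∀ t, C.liveFn G aX.rev tx₁ t = γ₁ := fun t => by
    have := liveFn_trivConst hop₁ aX.rev t; rwa [hrev] at this
  have hGx' : C.arg G aX.rev.rev = .var x := by rw [Fin.rev_rev]; exact hGx
  have hBx' : C.arg B aB.rev.rev = .var x := by rw [Fin.rev_rev]; exact hBx
  rcases isAndOp_or_isAffineOp (C.op B) with hBand | hBaff
  · -- `B` is ∧-type: as for a compact troubled pair
    obtain ⟨α₂, β₂, γ₂, hop₂⟩ := hBand
    let tz₂ : Bool := if aB = 0 then α₂ else β₂
    let tx₂ : Bool := if aB = 0 then β₂ else α₂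
    have htz₂ : ∀ t, C.liveFn B aB tz₂ t = γ₂ := liveFn_trivConst hop₂ aB
    have htx₂ : ∀ t, C.liveFn B aB.rev tx₂ t = γ₂ := fun t => by
      have := liveFn_trivConst hop₂ aB.rev t; rwa [hrev] at this
    by_cases hz12 : tz₁ = tz₂
    · -- `x := tz₁` trivializes both
      refine pair_const hf hd hF hC hP hφ0.le (by linarith) hI.le αQ hne hxy hGx hGy hBx hBy' hcfg.fanout_y hxP hyP
        (b := tz₁) (by rw [htz₁, htz₁]) ?_
      rw [hz12, htz₂, htz₂]
    by_cases hx12 : tx₁ = tx₂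
    · -- `y := tx₁` trivializes both
      refine pair_const hf hd hF hC hP hφ0.le (by linarith) hI.le αQ hne hxy.symm hGy hGx' hBy' hBx' hcfg.fanout_x hyP hxP
        (b := tx₁) (by rw [htx₁, htx₁]) ?_
      rw [hx12, htx₂, htx₂]
    · -- the affine substitution `x := y ⊕ b`
      let b : Bool := !(tx₁ ^^ tz₁)
      have hb₂ : (!(tx₂ ^^ tz₂)) = b := by
        have h1 : tz₂ = !tz₁ := by revert hz12; cases tz₁ <;> cases tz₂ <;> simp
        have h2 : tx₂ = !tx₁ := by revert hx12; cases tx₁ <;> cases tx₂ <;> simp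
        show (!(tx₂ ^^ tz₂)) = !(tx₁ ^^ tz₁)
        rw [h1, h2]; cases tx₁ <;> cases tz₁ <;> rfl
      refine pair_affine hf hd hF hC hP hφ0.le hφ.le hI.le αQ hne hxy.symm hGy hGx' hBy' hBx' hcfg.fanout_y hcfg.fanout_x
        hyP hxP (b := b) γ₁ γ₂ (fun t => ?_) (fun t => ?_)
      · rw [C.substVar_op_self hxy.symm hGx hGy]
        exact and_sameVar_const hop₁ aX t
      · rw [C.substVar_op_self hxy.symm hBx hBy', ← hb₂]
        exact and_sameVar_const hop₂ aB t
  · -- `B` is ⊕-type: the affine substitution `x := y ⊕ b` makes it constant for every `b`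
    obtain ⟨γ₂, hop₂⟩ := C.isXorOp_of_isAffineOp hS.nonDegenerate hBaff
    let b : Bool := !(tx₁ ^^ tz₁)
    refine pair_affine hf hd hF hC hP hφ0.le hφ.le hI.le αQ hne hxy.symm hGy hGx' hBy' hBx' hcfg.fanout_y hcfg.fanout_x
      hyP hxP (b := b) γ₁ (b ^^ γ₂) (fun t => ?_) (fun t => ?_)
    · rw [C.substVar_op_self hxy.symm hGx hGy]
      exact and_sameVar_const hop₁ aX t
    · rw [C.substVar_op_self hxy.symm hBx hBy']
      split_ifs <;> rw [hop₂] <;> cases t <;> cases b <;> cases γ₂ <;> rfl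

end Literature.Computability.Complexity
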